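import Mathlib
import HarnessLib
import Literature.Analysis.FunctionSpaces.SmoothParametricIntegral
import Summits.NavierStokesRegularity.NavierStokesRegularity.Theorems.UnthreadedRigidityDoorUnthreadedRigidityHornPressureDefs
import Summits.NavierStokesRegularity.NavierStokesRegularity.Theorems.UnthreadedRigidityDoorUnthreadedRigidityProfileHornMoments

/-!
# Route `UnthreadedRigidityDoor`, item `UnthreadedRigidity` (W2, stmt-NavierStokesRegularity-27585) — LINE g10-2 «PROFILE HORN»,
# BRIDGE PH (L-part `ThreadingJets.HornSliceIdentityTwo`), file 2: THE RADIAL LAYER OF A MULTIPOLE CHANNEL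

Prover file (W2 Lean hand ns-crc-p1 g9, by lineage; `--supports stmt-NavierStokesRegularity-27585 --as helper`).  One-dimensional real analysis
of the objects `Gin`, `Gout`, `radCoeff` of `…HornPressureDefs` (p717811) for a smooth channel `g` with decay `|g(σ)| ≤ K/σ^{L+2}` on `[1,∞)`:

* `contDiff_Gin` — `s ↦ Gin L g s = ∫₀¹ t^{2L+2} g(st²) dt` is smooth on `ℝ` (Literature `contDiff_parametric_intervalIntegral`); `Gin_zero`;
  `integral_pow_mul_eq_Gin` — the r-picture `∫₀ʳ ρ^{2L+2} g(ρ²) dρ = r^{2L+3} Gin(r²)`; `two_mul_deriv_Gin` — the ODE `2s Gin′ = g − (2L+3) Gin`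
  on `[0,∞)` (FTC at `r = √s` and uniqueness of derivatives);
* `Gout_eq_sub`, `hasDerivAt_Gout` (`Gout′ = −g`), `contDiff_Gout`, the tail bound `abs_Gout_le` (`|Gout(s)| ≤ K/((L+1)s^{L+1})`),
  `tendsto_Gout_atTop`, and the r-picture `integral_Ioi_mul_eq_Gout` (`∫_(r,∞) ρ g(ρ²) dρ = Gout(r²)/2`, FTC on `(r,∞)`);
* `contDiff_radCoeff`, `deriv_radCoeff` (`β′ = −Gin/2` on `[0,∞)`), ★ `radCoeff_ode` (`4sβ″ + (4L+6)β′ = −g` on `(0,∞)` — i.e.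
  `b″ + (2L+2)b′/r = −a_L` for `b(r) = β(r²)`, `a_L(ρ) = g(ρ²)`), ★ `eulerCoeff_radCoeff` (`2r²β′(r²) + Lβ(r²)` = the expression defining
  `ProfileHorn.eulerPressure a_L L r`), and the decay ★ `abs_radCoeff_sq_le` (`|β(r²)| ≤ C/r^{2L+1}` on `[1,∞)`).

HONEST LABEL: one-dimensional calculus serving the L-part of ONE bridge of a RUNG line about SPECIAL (separable `l = 2`) slice data;
`UnthreadedRigidity` (27585), W2 and NS regularity remain OPEN; nothing here is a statement about the Navier–Stokes equations.  0 kit.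
-/

-- the summit and its single sub-problem share the name (CONVENTIONS §1), as in every Theorems file
set_option linter.dupNamespace false

noncomputable section

namespace Summit.NavierStokesRegularity.NavierStokesRegularity.Theorems.UnthreadedRigidity.HornPressure

open scoped Topology ContDiff
open Filter Set MeasureTheory
open Summit.NavierStokesRegularity.NavierStokesRegularity.Theorems.UnthreadedRigidity.ProfileHorn
  (integrableOn_Ioi_of_decay innerMoment outerMoment eulerPressure)

variable {g : ℝ → ℝ} {K : ℝ}

/-! ## The scaled inner moment `Gin` -/

/-- `Gin L g` is smooth on `ℝ` when `g` is (differentiation under the integral sign). -/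
theorem contDiff_Gin (hg : ContDiff ℝ ∞ g) (L : ℕ) : ContDiff ℝ ∞ (Gin L g) := by
  have hH : ContDiff ℝ ∞ (fun q : ℝ × ℝ => q.1 ^ (2 * L + 2) * g (q.2 * q.1 ^ 2)) :=
    (contDiff_fst.pow _).mul (hg.comp (contDiff_snd.mul (contDiff_fst.pow 2)))
  exact Literature.Analysis.FunctionSpaces.contDiff_parametric_intervalIntegral hH 0 1

/-- value at the apex: `Gin L g 0 = g(0)/(2L+3)`. -/
theorem Gin_zero (g : ℝ → ℝ) (L : ℕ) : Gin L g 0 = g 0 / (2 * L + 3) := by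
  simp only [Gin, zero_mul]
  rw [intervalIntegral.integral_mul_const, integral_pow]
  push_cast
  ring

/-- r-picture: `∫₀ʳ ρ^{2L+2} g(ρ²) dρ = r^{2L+3} · Gin L g (r²)`. -/
theorem integral_pow_mul_eq_Gin (g : ℝ → ℝ) (L : ℕ) (r : ℝ) :
    ∫ ρ in (0 : ℝ)..r, ρ ^ (2 * L + 2) * g (ρ ^ 2) = r ^ (2 * L + 3) * Gin L g (r ^ 2) := by
  have h := intervalIntegral.smul_integral_comp_mul_left (f := fun ρ : ℝ => ρ ^ (2 * L + 2) * g (ρ ^ 2))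
    (a := 0) (b := 1) r
  simp only [mul_zero, mul_one, smul_eq_mul] at h
  rw [← h, Gin, ← intervalIntegral.integral_const_mul, ← intervalIntegral.integral_const_mul]
  refine intervalIntegral.integral_congr fun t _ => ?_
  simp only [mul_pow]
  ring

/-- the radial ODE behind `Gin`, for `s ≥ 0`: `2 s · Gin′(s) = g(s) − (2L+3)·Gin(s)`
(at `s = r² > 0` this is `d/dr ∫₀ʳ ρ^{2L+2} g(ρ²) dρ = r^{2L+2} g(r²)`). -/
theorem two_mul_deriv_Gin (hg : ContDiff ℝ ∞ g) (L : ℕ) {s : ℝ} (hs : 0 ≤ s) :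
    2 * s * deriv (Gin L g) s = g s - (2 * L + 3) * Gin L g s := by
  rcases hs.eq_or_lt with h0 | hpos
  · rw [← h0, Gin_zero]
    field_simp
    ring
  set r := Real.sqrt s with hr
  have hr0 : 0 < r := Real.sqrt_pos.2 hpos
  have hrs : r ^ 2 = s := Real.sq_sqrt hpos.le
  have hgc : Continuous g := hg.continuous
  -- FTC for `I(ρ) = ∫₀^ρ x^{2L+2} g(x²) dx`
  have hf : Continuous fun x : ℝ => x ^ (2 * L + 2) * g (x ^ 2) := by fun_prop
  have hI : HasDerivAt (fun ρ => ∫ x in (0 : ℝ)..ρ, x ^ (2 * L + 2) * g (x ^ 2)) (r ^ (2 * L + 2) * g (r ^ 2)) r :=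
    intervalIntegral.integral_hasDerivAt_right (hf.intervalIntegrable _ _) (hf.stronglyMeasurableAtFilter _ _) hf.continuousAt
  -- the same function is `ρ^{2L+3} Gin(ρ²)`
  have hGd : Differentiable ℝ (Gin L g) := (contDiff_Gin hg L).differentiable (by simp)
  have hJ : HasDerivAt (fun ρ => ρ ^ (2 * L + 3) * Gin L g (ρ ^ 2))
      ((2 * L + 3 : ℕ) * r ^ (2 * L + 2) * Gin L g (r ^ 2) + r ^ (2 * L + 3) * (deriv (Gin L g) (r ^ 2) * (2 * r))) r := by
    have h1 : HasDerivAt (fun ρ : ℝ => ρ ^ (2 * L + 3)) ((2 * L + 3 : ℕ) * r ^ (2 * L + 2)) r := by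
      simpa using hasDerivAt_pow (2 * L + 3) r
    have h2 : HasDerivAt (fun ρ : ℝ => Gin L g (ρ ^ 2)) (deriv (Gin L g) (r ^ 2) * (2 * r)) r := by
      have hsq : HasDerivAt (fun ρ : ℝ => ρ ^ 2) (2 * r) r := by simpa using hasDerivAt_pow 2 r
      exact (hGd _).hasDerivAt.comp r hsq
    exact h1.mul h2
  have heq : (fun ρ => ∫ x in (0 : ℝ)..ρ, x ^ (2 * L + 2) * g (x ^ 2)) = fun ρ => ρ ^ (2 * L + 3) * Gin L g (ρ ^ 2) :=
    funext fun ρ => integral_pow_mul_eq_Gin g L ρ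
  rw [heq] at hI
  have huniq := hJ.unique hI
  rw [hrs] at huniq
  push_cast at huniq
  -- divide by `r^{2L+2} > 0`
  have hp : 0 < r ^ (2 * L + 2) := pow_pos hr0 _
  have hr3 : r ^ (2 * L + 3) = r ^ (2 * L + 2) * r := pow_succ r (2 * L + 2)
  rw [hr3] at huniq
  have key : r ^ (2 * L + 2) * ((2 * L + 3) * Gin L g s + 2 * s * deriv (Gin L g) s - g s) = 0 := by
    linear_combination huniq - 2 * r ^ (2 * L + 2) * deriv (Gin L g) s * hrs
  have := (mul_eq_zero.1 key).resolve_left hp.ne'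
  linarith

/-! ## The outer moment `Gout` -/

/-- nonnegativity of the decay constant. -/
theorem decayConst_nonneg {m : ℕ} (hK : ∀ σ : ℝ, 1 ≤ σ → |g σ| ≤ K / σ ^ m) : 0 ≤ K := by
  have := hK 1 le_rfl
  simp at this
  exact (abs_nonneg _).trans this

/-- a decaying continuous channel is integrable on every `(a, ∞)`. -/
theorem integrableOn_Ioi_channel (hgc : Continuous g) {m : ℕ} (hK : ∀ σ : ℝ, 1 ≤ σ → |g σ| ≤ K / σ ^ (m + 2)) (a : ℝ) :
    IntegrableOn g (Ioi a) := by
  refine integrableOn_Ioi_of_decay hgc (K := K) fun σ hσ => (hK σ hσ).trans ?_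
  have hK0 := decayConst_nonneg hK
  have hσ0 : 0 < σ := by linarith
  rw [pow_add, ← div_div]
  exact div_le_div_of_nonneg_right (div_le_self hK0 (one_le_pow₀ hσ)) (by positivity)

/-- `Gout` as a primitive: `Gout g s = Gout g c − ∫_c^s g`. -/
theorem Gout_eq_sub (hgc : Continuous g) {m : ℕ} (hK : ∀ σ : ℝ, 1 ≤ σ → |g σ| ≤ K / σ ^ (m + 2)) (c s : ℝ) :
    Gout g s = Gout g c - ∫ x in c..s, g x := by
  have h := intervalIntegral.integral_Ioi_sub_Ioi' (integrableOn_Ioi_channel hgc hK c) (integrableOn_Ioi_channel hgc hK s)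
  unfold Gout
  linarith

/-- `Gout′ = −g`. -/
theorem hasDerivAt_Gout (hgc : Continuous g) {m : ℕ} (hK : ∀ σ : ℝ, 1 ≤ σ → |g σ| ≤ K / σ ^ (m + 2)) (s : ℝ) :
    HasDerivAt (Gout g) (-g s) s := by
  have heq : Gout g = fun x => Gout g 0 - ∫ t in (0 : ℝ)..x, g t := funext fun x => Gout_eq_sub hgc hK 0 x
  rw [heq]
  have hI : HasDerivAt (fun x => ∫ t in (0 : ℝ)..x, g t) (g s) s :=
    intervalIntegral.integral_hasDerivAt_right (hgc.intervalIntegrable _ _) (hgc.stronglyMeasurableAtFilter _ _) hgc.continuousAt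
  have h := (hasDerivAt_const s (Gout g 0)).fun_sub hI
  rw [zero_sub] at h
  exact h

/-- `deriv Gout = −g`. -/
theorem deriv_Gout (hgc : Continuous g) {m : ℕ} (hK : ∀ σ : ℝ, 1 ≤ σ → |g σ| ≤ K / σ ^ (m + 2)) :
    deriv (Gout g) = fun s => -g s := funext fun s => (hasDerivAt_Gout hgc hK s).deriv

/-- `Gout g` is smooth when `g` is. -/
theorem contDiff_Gout (hg : ContDiff ℝ ∞ g) {m : ℕ} (hK : ∀ σ : ℝ, 1 ≤ σ → |g σ| ≤ K / σ ^ (m + 2)) :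
    ContDiff ℝ ∞ (Gout g) := by
  rw [contDiff_infty_iff_deriv, deriv_Gout hg.continuous hK]
  exact ⟨fun s => (hasDerivAt_Gout hg.continuous hK s).differentiableAt, hg.neg⟩

/-- tail bound: `|Gout g s| ≤ K/((m+1) s^{m+1})` for `s ≥ 1`. -/
theorem abs_Gout_le (hgc : Continuous g) {m : ℕ} (hK : ∀ σ : ℝ, 1 ≤ σ → |g σ| ≤ K / σ ^ (m + 2)) {s : ℝ} (hs : 1 ≤ s) :
    |Gout g s| ≤ K / ((m + 1) * s ^ (m + 1)) := by
  have hs0 : 0 < s := by linarith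
  have hK0 := decayConst_nonneg hK
  have hlt : (-((m + 2 : ℕ) : ℝ)) < -1 := by push_cast; linarith
  have hmaj : IntegrableOn (fun σ : ℝ => K * σ ^ (-((m + 2 : ℕ) : ℝ))) (Ioi s) :=
    (integrableOn_Ioi_rpow_of_lt hlt hs0).const_mul K
  have hpt : ∀ σ ∈ Ioi s, ‖g σ‖ ≤ K * σ ^ (-((m + 2 : ℕ) : ℝ)) := by
    intro σ hσ
    have hσ1 : 1 ≤ σ := hs.trans (le_of_lt hσ)
    have hσ0 : 0 < σ := by linarith
    rw [Real.norm_eq_abs, Real.rpow_neg hσ0.le, Real.rpow_natCast, ← div_eq_mul_inv]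
    exact hK σ hσ1
  have htail : ∫ σ in Ioi s, K * σ ^ (-((m + 2 : ℕ) : ℝ)) = K / ((m + 1) * s ^ (m + 1)) := by
    rw [integral_const_mul, integral_Ioi_rpow_of_lt hlt hs0]
    have h1 : (-((m + 2 : ℕ) : ℝ)) + 1 = -((m + 1 : ℕ) : ℝ) := by push_cast; ring
    rw [h1, Real.rpow_neg hs0.le, Real.rpow_natCast]
    push_cast
    field_simp
  unfold Gout
  calc |∫ σ in Ioi s, g σ| = ‖∫ σ in Ioi s, g σ‖ := (Real.norm_eq_abs _).symm
    _ ≤ ∫ σ in Ioi s, ‖g σ‖ := norm_integral_le_integral_norm _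
    _ ≤ ∫ σ in Ioi s, K * σ ^ (-((m + 2 : ℕ) : ℝ)) :=
        setIntegral_mono_on (integrableOn_Ioi_channel hgc hK s).norm hmaj measurableSet_Ioi hpt
    _ = K / ((m + 1) * s ^ (m + 1)) := htail

/-- `Gout g s → 0` as `s → ∞`. -/
theorem tendsto_Gout_atTop (hgc : Continuous g) {m : ℕ} (hK : ∀ σ : ℝ, 1 ≤ σ → |g σ| ≤ K / σ ^ (m + 2)) :
    Tendsto (Gout g) atTop (𝓝 0) := by
  have hK0 := decayConst_nonneg hK
  have hb : Tendsto (fun s : ℝ => K / ((m + 1) * s ^ (m + 1))) atTop (𝓝 0) := by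
    have : Tendsto (fun s : ℝ => (m + 1) * s ^ (m + 1)) atTop atTop :=
      (tendsto_pow_atTop (by omega)).const_mul_atTop (by positivity)
    exact tendsto_const_nhds.div_atTop this
  refine squeeze_zero_norm' ?_ hb
  filter_upwards [eventually_ge_atTop (1 : ℝ)] with s hs
  rw [Real.norm_eq_abs]
  exact abs_Gout_le hgc hK hs

/-- r-picture of `Gout`: `∫_(r,∞) ρ g(ρ²) dρ = Gout g (r²)/2` (`r ≥ 0`). -/
theorem integral_Ioi_mul_eq_Gout (hg : ContDiff ℝ ∞ g) {m : ℕ} (hK : ∀ σ : ℝ, 1 ≤ σ → |g σ| ≤ K / σ ^ (m + 2))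
    (r : ℝ) :
    ∫ ρ in Ioi r, ρ * g (ρ ^ 2) = Gout g (r ^ 2) / 2 := by
  have hgc := hg.continuous
  -- `Φ(ρ) = −Gout(ρ²)/2` has derivative `ρ g(ρ²)` and tends to `0`
  have hΦ : ∀ ρ : ℝ, HasDerivAt (fun ρ : ℝ => -(Gout g (ρ ^ 2)) / 2) (ρ * g (ρ ^ 2)) ρ := by
    intro ρ
    have hsq : HasDerivAt (fun x : ℝ => x ^ 2) (2 * ρ) ρ := by simpa using hasDerivAt_pow 2 ρ
    have hG' : HasDerivAt (Gout g) (-g (ρ ^ 2)) (ρ ^ 2) := hasDerivAt_Gout hgc hK (ρ ^ 2)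
    have h3 := HasDerivAt.comp (h₂ := Gout g) (h := fun x : ℝ => x ^ 2) ρ hG' hsq
    have h4 := (h3.neg).div_const 2
    refine (h4.congr_of_eventuallyEq (Eventually.of_forall fun x => rfl)).congr_deriv ?_
    ring
  have hlim : Tendsto (fun ρ : ℝ => -(Gout g (ρ ^ 2)) / 2) atTop (𝓝 0) := by
    have h1 : Tendsto (fun ρ : ℝ => Gout g (ρ ^ 2)) atTop (𝓝 0) :=
      (tendsto_Gout_atTop hgc hK).comp (tendsto_pow_atTop (by norm_num))
    have h2 : Tendsto (fun ρ : ℝ => -(Gout g (ρ ^ 2)) / 2) atTop (𝓝 (-0 / 2)) := h1.neg.div_const 2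
    rw [neg_zero, zero_div] at h2
    exact h2
  -- integrability of `ρ g(ρ²)` on `(r, ∞)`: decay `|ρ g(ρ²)| ≤ K/ρ^3 ≤ K/ρ²` on `[1,∞)`
  have hK0 := decayConst_nonneg hK
  have hint : IntegrableOn (fun ρ : ℝ => ρ * g (ρ ^ 2)) (Ioi r) := by
    refine integrableOn_Ioi_of_decay (by fun_prop) (K := K) fun ρ hρ => ?_
    have hρ0 : 0 < ρ := by linarith
    have hρ2 : 1 ≤ ρ ^ 2 := by nlinarith
    have hg2 := hK (ρ ^ 2) hρ2
    rw [abs_mul, abs_of_pos hρ0]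
    calc ρ * |g (ρ ^ 2)| ≤ ρ * (K / (ρ ^ 2) ^ (m + 2)) := mul_le_mul_of_nonneg_left hg2 hρ0.le
      _ ≤ ρ * (K / ρ ^ 3) := by
          apply mul_le_mul_of_nonneg_left _ hρ0.le
          apply div_le_div_of_nonneg_left hK0 (by positivity)
          calc ρ ^ 3 ≤ ρ ^ 4 := pow_le_pow_right₀ hρ (by norm_num)
            _ = (ρ ^ 2) ^ 2 := by ring
            _ ≤ (ρ ^ 2) ^ (m + 2) := pow_le_pow_right₀ hρ2 (by omega)
      _ = K / ρ ^ 2 := by field_simp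
  have key := integral_Ioi_of_hasDerivAt_of_tendsto (f := fun ρ : ℝ => -(Gout g (ρ ^ 2)) / 2)
    (hΦ r).continuousAt.continuousWithinAt (fun x _ => hΦ x) hint hlim
  rw [key]
  ring

/-! ## The radial coefficient `radCoeff` -/

/-- `radCoeff L g` is smooth. -/
theorem contDiff_radCoeff (hg : ContDiff ℝ ∞ g) (L : ℕ) (hK : ∀ σ : ℝ, 1 ≤ σ → |g σ| ≤ K / σ ^ (L + 2)) :
    ContDiff ℝ ∞ (radCoeff L g) := by
  unfold radCoeff
  exact ((contDiff_id.mul (contDiff_Gin hg L)).add ((contDiff_Gout hg hK).div_const 2)).div_const _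

/-- `radCoeff′ = −Gin/2` on `[0, ∞)`. -/
theorem deriv_radCoeff (hg : ContDiff ℝ ∞ g) (L : ℕ) (hK : ∀ σ : ℝ, 1 ≤ σ → |g σ| ≤ K / σ ^ (L + 2)) {s : ℝ} (hs : 0 ≤ s) :
    deriv (radCoeff L g) s = -(Gin L g s) / 2 := by
  have hGd : Differentiable ℝ (Gin L g) := (contDiff_Gin hg L).differentiable (by simp)
  have h1 : HasDerivAt (fun x => x * Gin L g x) (1 * Gin L g s + s * deriv (Gin L g) s) s :=
    (hasDerivAt_id s).mul (hGd s).hasDerivAt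
  have h2 : HasDerivAt (fun x => Gout g x / 2) (-g s / 2) s := (hasDerivAt_Gout hg.continuous hK s).div_const 2
  have h3 : HasDerivAt (radCoeff L g) ((1 * Gin L g s + s * deriv (Gin L g) s + -g s / 2) / (2 * L + 1)) s := by
    have := (h1.add h2).div_const (2 * (L : ℝ) + 1)
    exact this
  rw [h3.deriv]
  have hode := two_mul_deriv_Gin hg L hs
  have hL : (2 * (L : ℝ) + 1) ≠ 0 := by positivity
  field_simp
  linarith

/-- the RADIAL ODE of the multipole coefficient, for `s > 0`: `4 s β″ + (4L+6) β′ = −g` (`β = radCoeff L g`; at `s = r²` this is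
`b″ + (2L+2) b′/r = −a_L` for `b(r) = β(r²)`, `a_L(r) = g(r²)`). -/
theorem radCoeff_ode (hg : ContDiff ℝ ∞ g) (L : ℕ) (hK : ∀ σ : ℝ, 1 ≤ σ → |g σ| ≤ K / σ ^ (L + 2)) {s : ℝ} (hs : 0 < s) :
    4 * s * deriv (deriv (radCoeff L g)) s + (4 * L + 6) * deriv (radCoeff L g) s = -g s := by
  -- near `s > 0`, `β′ = −Gin/2`
  have hev : deriv (radCoeff L g) =ᶠ[𝓝 s] fun x => -(Gin L g x) / 2 := by
    filter_upwards [Ioi_mem_nhds hs] with x hx using deriv_radCoeff hg L hK (le_of_lt hx)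
  have hGd : Differentiable ℝ (Gin L g) := (contDiff_Gin hg L).differentiable (by simp)
  have h2 : deriv (deriv (radCoeff L g)) s = -(deriv (Gin L g) s) / 2 := by
    rw [hev.deriv_eq]
    exact ((hGd s).hasDerivAt.neg.div_const 2).deriv
  rw [h2, deriv_radCoeff hg L hK hs.le]
  have hode := two_mul_deriv_Gin hg L hs.le
  linarith

/-- THE EULER COEFFICIENT in the r-picture: for `r > 0`,
`2 r² β′(r²) + L β(r²) = −((L+1)/(2L+1)) r^{−(2L+1)} ∫₀ʳ ρ^{2L+2} g(ρ²) dρ + (L/(2L+1)) ∫_(r,∞) ρ g(ρ²) dρ`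
(= `ProfileHorn.eulerPressure a L r` for the channel `a(ρ) = g(ρ²)`). -/
theorem eulerCoeff_radCoeff (hg : ContDiff ℝ ∞ g) (L : ℕ) (hK : ∀ σ : ℝ, 1 ≤ σ → |g σ| ≤ K / σ ^ (L + 2))
    {r : ℝ} (hr : 0 < r) :
    2 * r ^ 2 * deriv (radCoeff L g) (r ^ 2) + L * radCoeff L g (r ^ 2) =
      -(((L : ℝ) + 1) / (2 * L + 1)) * (r ^ (2 * L + 1))⁻¹ * (∫ ρ in (0 : ℝ)..r, ρ ^ (2 * L + 2) * g (ρ ^ 2))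
        + ((L : ℝ) / (2 * L + 1)) * ∫ ρ in Ioi r, ρ * g (ρ ^ 2) := by
  rw [deriv_radCoeff hg L hK (sq_nonneg r), integral_pow_mul_eq_Gin, integral_Ioi_mul_eq_Gout hg hK r, radCoeff]
  have hr0 : r ≠ 0 := hr.ne'
  have hL : (2 * (L : ℝ) + 1) ≠ 0 := by positivity
  have h21 : r ^ (2 * L + 3) = r ^ (2 * L + 1) * r ^ 2 := by ring
  rw [h21]
  field_simp
  ring

/-- uniform bound of the inner moment: `|∫₀ʳ ρ^{2L+2} g(ρ²) dρ| ≤ ∫_(0,∞) |ρ^{2L+2} g(ρ²)|` (finite by the decay of `g`). -/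
theorem abs_innerIntegral_le (hgc : Continuous g) (L : ℕ) (hK : ∀ σ : ℝ, 1 ≤ σ → |g σ| ≤ K / σ ^ (L + 2))
    {r : ℝ} (hr : 0 ≤ r) :
    |∫ ρ in (0 : ℝ)..r, ρ ^ (2 * L + 2) * g (ρ ^ 2)| ≤ ∫ ρ in Ioi 0, |ρ ^ (2 * L + 2) * g (ρ ^ 2)| := by
  have hK0 := decayConst_nonneg hK
  have hf : Continuous fun ρ : ℝ => ρ ^ (2 * L + 2) * g (ρ ^ 2) := by fun_prop
  have hint : IntegrableOn (fun ρ : ℝ => ρ ^ (2 * L + 2) * g (ρ ^ 2)) (Ioi 0) := by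
    refine integrableOn_Ioi_of_decay hf (K := K) fun ρ hρ => ?_
    have hρ0 : 0 < ρ := by linarith
    have hρ2 : 1 ≤ ρ ^ 2 := by nlinarith
    rw [abs_mul, abs_of_nonneg (by positivity)]
    calc ρ ^ (2 * L + 2) * |g (ρ ^ 2)| ≤ ρ ^ (2 * L + 2) * (K / (ρ ^ 2) ^ (L + 2)) :=
          mul_le_mul_of_nonneg_left (hK _ hρ2) (by positivity)
      _ = K / ρ ^ 2 := by field_simp; ring
  rw [intervalIntegral.integral_of_le hr]
  calc |∫ ρ in Ioc 0 r, ρ ^ (2 * L + 2) * g (ρ ^ 2)| ≤ ∫ ρ in Ioc 0 r, |ρ ^ (2 * L + 2) * g (ρ ^ 2)| :=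
        abs_integral_le_integral_abs
    _ ≤ ∫ ρ in Ioi 0, |ρ ^ (2 * L + 2) * g (ρ ^ 2)| :=
        setIntegral_mono_set hint.abs (Eventually.of_forall fun _ => abs_nonneg _) (Eventually.of_forall Ioc_subset_Ioi_self)

/-- DECAY of the multipole coefficient: `|β_L(r²)| ≤ C / r^{2L+1}` for `r ≥ 1`. -/
theorem abs_radCoeff_sq_le (hg : ContDiff ℝ ∞ g) (L : ℕ) (hK : ∀ σ : ℝ, 1 ≤ σ → |g σ| ≤ K / σ ^ (L + 2)) :
    ∃ C : ℝ, ∀ r : ℝ, 1 ≤ r → |radCoeff L g (r ^ 2)| ≤ C / r ^ (2 * L + 1) := by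
  set M := ∫ ρ in Ioi 0, |ρ ^ (2 * L + 2) * g (ρ ^ 2)| with hM
  have hK0 := decayConst_nonneg hK
  refine ⟨M + K, fun r hr => ?_⟩
  have hr0 : 0 < r := by linarith
  have hGin : r ^ 2 * Gin L g (r ^ 2) = (r ^ (2 * L + 1))⁻¹ * ∫ ρ in (0 : ℝ)..r, ρ ^ (2 * L + 2) * g (ρ ^ 2) := by
    rw [integral_pow_mul_eq_Gin]
    field_simp
    ring
  have h1 : |r ^ 2 * Gin L g (r ^ 2)| ≤ M / r ^ (2 * L + 1) := by
    rw [hGin, abs_mul, abs_inv, abs_of_pos (pow_pos hr0 _), div_eq_inv_mul]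
    exact mul_le_mul_of_nonneg_left (abs_innerIntegral_le hg.continuous L hK hr0.le) (by positivity)
  have h2 : |Gout g (r ^ 2)| ≤ K / r ^ (2 * L + 1) := by
    have hr2 : 1 ≤ r ^ 2 := by nlinarith
    refine (abs_Gout_le hg.continuous hK hr2).trans ?_
    rw [← pow_mul]
    apply div_le_div_of_nonneg_left hK0 (by positivity)
    calc r ^ (2 * L + 1) ≤ r ^ (2 * (L + 1)) := pow_le_pow_right₀ hr (by omega)
      _ ≤ (L + 1) * r ^ (2 * (L + 1)) := le_mul_of_one_le_left (by positivity) (by norm_cast; omega)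
  have hL1 : (1 : ℝ) ≤ 2 * (L : ℝ) + 1 := by norm_cast; omega
  unfold radCoeff
  rw [abs_div, abs_of_pos (by positivity : (0:ℝ) < 2 * (L : ℝ) + 1)]
  calc |r ^ 2 * Gin L g (r ^ 2) + Gout g (r ^ 2) / 2| / (2 * (L : ℝ) + 1)
      ≤ |r ^ 2 * Gin L g (r ^ 2) + Gout g (r ^ 2) / 2| := div_le_self (abs_nonneg _) hL1
    _ ≤ |r ^ 2 * Gin L g (r ^ 2)| + |Gout g (r ^ 2) / 2| := abs_add_le _ _
    _ ≤ M / r ^ (2 * L + 1) + K / r ^ (2 * L + 1) := by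
        refine add_le_add h1 ?_
        rw [abs_div, abs_two]
        have := h2
        have hpos : 0 ≤ |Gout g (r ^ 2)| := abs_nonneg _
        linarith
    _ = (M + K) / r ^ (2 * L + 1) := by ring

end Summit.NavierStokesRegularity.NavierStokesRegularity.Theorems.UnthreadedRigidity.HornPressure

end
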